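import Literature.Probability.RandomPlanarGeometry.SAWKestenRelation
import Literature.Probability.RandomPlanarGeometry.SAWTriangularConnectiveConstantLower
import HarnessLib

/-!
# A certified lower bound `μ(ℤ⁴) > 5.87` for the connective constant of the hypercubic lattice `ℤ⁴`,
# by Kesten's irreducible-bridge inequality and kernel-certified counts `λ_n(ℤ⁴)`, `n ≤ 9`

Topic `Literature/Probability/RandomPlanarGeometry` (the `d = 4` twin of `SAWCubicConnectiveConstantLower.lean`;
continues `SAWKestenRelation.lean`: Kesten's relation `Σ_k λ_k μ^{-k} = 1` on every `ℤ^d`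
(`Zd.MadrasSlade1993_eq424_holds`) and the certificate principle `Zd.inv_lt_connectiveConstant_of_one_lt_sum` —
any truncation of `Σ_k λ_k x^k` exceeding `1` at `x > 0` certifies `μ(ℤ^d) > 1/x`; the lattice-free certificate
plumbing of `SAWTriangularConnectiveConstantLower.lean` is reused by name: `TriIrrCert.segB` / `irrB` / `leafOK` /
`scanl_eq_map_range`; the integer encoding `enc` is re-done for eight letters). Sources: Kesten's method (H. Kesten, J. Math. Phys. 4
(1963) 960–969, §4) as used for printed lower bounds by I. Jensen, J. Phys. A 37 (2004) 11521–11529, §2 ("if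
`0 ≤ ã_n ≤ a_n` … `1/x_c` is a lower bound on `μ`. In particular we can set `ã_n = 0` for `n > N` and thus truncate
the series"); N. Madras, G. Slade, *The Self-Avoiding Walk* (1993), §1.2, (1.2.15)–(1.2.17) (p. 11), §4.2,
eq. (4.2.3)–(4.2.4) (pp. 90–91), and Table 1.1 (p. 12: `d = 4`: lower `6.71800` (Hara–Slade 1992b), estimate
`6.7720 ± 0.0005`, upper `6.832`). The printed rigorous lower bound of record for `ℤ⁴` is `μ ≥ 6.742945` (T. Hara,
G. Slade, A. D. Sokal, J. Stat. Phys. 72 (1993) 479–517, results table, by an analytic method, not by bridges); no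
irreducible-bridge truncation bound for `ℤ⁴` was located in print (lane literature cell, lit-2 g13). The present
bound is numerically WEAKER than both printed bounds — what is new is only that it is kernel-checked, lifting the
tree's `d + 1/2 = 9/2 ≤ μ(ℤ⁴)` (`nat_add_half_le_connectiveConstant`, `SAWDimensionGapBounds.lean`) to `5.87 < μ(ℤ⁴)`.

## What is here (namespace `Literature.Probability.RandomPlanarGeometry.SAW.Zd`)

* an eight-letter step-word model of the walks of `ℤ⁴` (`QuarticIrrCert.vec`, `traj`, `walkOf n w ∈ saws 4 n` for
  self-avoiding words, injectivity), the fast vertex list `posList` (`= (range (n+1)).map (quad ∘ traj w)`) and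
  height list `hts`; the acceptance test `QuarticIrrCert.WordOK n w` and its soundness
  `walkOf n w ∈ irreducibleBridges 4 n`; `QuarticIrrCert.certL` on the output of an UNTRUSTED half-space depth-first
  search and **`QuarticIrrCert.le_of_certL : certL n m L = true → m ≤ λ_n(ℤ⁴)`** (standard axioms);
* the evaluations (one `native_decide` each; computational class): `λ_n(ℤ⁴) ≥ 1, 6, 30, 150, 726, 3564, 17526,
  89094, 466824` for `n = 1, …, 9` (the exact values; only `≥` is certified and used);
* **`connectiveConstant_four_gt_587_div_100 : 587/100 < μ(ℤ⁴)`**, i.e. `μ(ℤ⁴) > 5.87`, from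
  `Σ_{n ≤ 9} λ_n (100/587)^n > 1` (exact rational arithmetic; the truncation root at `n ≤ 9` is `5.8744`).

Axioms: standard plus the nine `native_decide` count certificates (`Lean.ofReduceBool`).
-/


open Finset Literature.Probability.LatticeModels Literature.Probability.Percolation SimpleGraph
open scoped BigOperators

namespace Literature.Probability.RandomPlanarGeometry.SAW.Zd

namespace QuarticIrrCert

open TriIrrCert (segB irrB leafOK scanl_eq_map_range)

/-- Integer encoding of an eight-letter step word (base `9`, digits `a + 1`, most significant first); used only to
check that the emitted list is strictly increasing, hence duplicate-free. [cite: Jensen2004SAWLowerBounds, §2] -/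
def enc (w : List (Fin 8)) : ℕ := w.foldl (fun acc a => acc * 9 + (a.val + 1)) 0

/-- Strict order of encodings. [cite: Jensen2004SAWLowerBounds, §2] -/
def EncLT (v w : List (Fin 8)) : Prop := enc v < enc w

/-- `EncLT` is decidable. [cite: Jensen2004SAWLowerBounds, §2] -/
instance : DecidableRel EncLT := fun v w => inferInstanceAs (Decidable (enc v < enc w))

/-- `EncLT` is transitive. [cite: Jensen2004SAWLowerBounds, §2] -/
instance : Trans EncLT EncLT EncLT := ⟨fun h₁ h₂ => lt_trans h₁ h₂⟩

/-- A list strictly increasing in `enc` has no duplicates. [cite: Jensen2004SAWLowerBounds, §2] -/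
theorem nodup_of_chain {L : List (List (Fin 8))} (h : L.IsChain EncLT) : L.Nodup :=
  h.pairwise.imp fun hab heq => by subst heq; exact lt_irrefl _ hab

/-! ### Eight-letter step words for `ℤ⁴` -/

/-- First coordinate of the step vector of the letter `a`
(`0 ↦ +e₀`, `1 ↦ −e₀`, `2 ↦ +e₁`, `3 ↦ −e₁`, `4 ↦ +e₂`, `5 ↦ −e₂`, `6 ↦ +e₃`, `7 ↦ −e₃`). [cite: MadrasSlade1993, §1.1] -/
def dx (a : Fin 8) : ℤ := ![1, -1, 0, 0, 0, 0, 0, 0] a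

/-- Second coordinate of the step vector. [cite: MadrasSlade1993, §1.1] -/
def dy (a : Fin 8) : ℤ := ![0, 0, 1, -1, 0, 0, 0, 0] a

/-- Third coordinate of the step vector. [cite: MadrasSlade1993, §1.1] -/
def dz (a : Fin 8) : ℤ := ![0, 0, 0, 0, 1, -1, 0, 0] a

/-- Fourth coordinate of the step vector. [cite: MadrasSlade1993, §1.1] -/
def dw (a : Fin 8) : ℤ := ![0, 0, 0, 0, 0, 0, 1, -1] a

/-- The step vector of the letter `a` (one of the eight unit steps `±eᵢ` of `ℤ⁴`). [cite: MadrasSlade1993, §1.1] -/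
def vec (a : Fin 8) : Site 4 := ![dx a, dy a, dz a, dw a]

/-- Each step vector is `+eᵢ` or `−eᵢ`. [cite: MadrasSlade1993, §1.1] -/
theorem vec_eq_single_or (a : Fin 8) : ∃ i : Fin 4, vec a = Pi.single i 1 ∨ vec a + Pi.single i 1 = 0 := by
  fin_cases a
  · exact ⟨0, Or.inl (by ext j; fin_cases j <;> simp [vec, dx, dy, dz, dw])⟩
  · exact ⟨0, Or.inr (by ext j; fin_cases j <;> simp [vec, dx, dy, dz, dw])⟩
  · exact ⟨1, Or.inl (by ext j; fin_cases j <;> simp [vec, dx, dy, dz, dw])⟩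
  · exact ⟨1, Or.inr (by ext j; fin_cases j <;> simp [vec, dx, dy, dz, dw])⟩
  · exact ⟨2, Or.inl (by ext j; fin_cases j <;> simp [vec, dx, dy, dz, dw])⟩
  · exact ⟨2, Or.inr (by ext j; fin_cases j <;> simp [vec, dx, dy, dz, dw])⟩
  · exact ⟨3, Or.inl (by ext j; fin_cases j <;> simp [vec, dx, dy, dz, dw])⟩
  · exact ⟨3, Or.inr (by ext j; fin_cases j <;> simp [vec, dx, dy, dz, dw])⟩

/-- `x ∼ x + vec a` in `ℤ⁴`. [cite: MadrasSlade1993, §1.1] -/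
theorem adj_add_vec (x : Site 4) (a : Fin 8) : (zdGraph 4).Adj x (x + vec a) := by
  rw [zdGraph_adj_iff]
  obtain ⟨i, h | h⟩ := vec_eq_single_or a
  · exact ⟨i, Or.inl (by rw [h])⟩
  · exact ⟨i, Or.inr (by rw [add_assoc, h, add_zero])⟩

/-- The letter is determined by its step vector. [cite: MadrasSlade1993, §1.1] -/
theorem vec_injective : Function.Injective vec := by
  unfold Function.Injective
  decide

/-- Endpoint of the word `w` started at the origin. [cite: MadrasSlade1993, §1.1] -/
def wEnd (w : List (Fin 8)) : Site 4 := (w.map vec).sum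

/-- `wEnd [] = 0`. [cite: MadrasSlade1993, §1.1] -/
@[simp] theorem wEnd_nil : wEnd [] = 0 := rfl

/-- `wEnd (a :: w) = vec a + wEnd w`. [cite: MadrasSlade1993, §1.1] -/
@[simp] theorem wEnd_cons (a : Fin 8) (w : List (Fin 8)) : wEnd (a :: w) = vec a + wEnd w := by
  simp [wEnd]

/-- `wEnd (w ++ w') = wEnd w + wEnd w'`. [cite: MadrasSlade1993, §1.1] -/
@[simp] theorem wEnd_append (w w' : List (Fin 8)) : wEnd (w ++ w') = wEnd w + wEnd w' := by
  simp [wEnd, List.sum_append]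

/-- Position after `i` steps (frozen at the endpoint for `i ≥ |w|`). [cite: MadrasSlade1993, §1.1] -/
def traj (w : List (Fin 8)) (i : ℕ) : Site 4 := wEnd (w.take i)

/-- The walk starts at the origin. [cite: MadrasSlade1993, §1.1] -/
@[simp] theorem traj_zero (w : List (Fin 8)) : traj w 0 = 0 := by simp [traj]

/-- One more step adds its vector. [cite: MadrasSlade1993, §1.1] -/
theorem traj_succ (w : List (Fin 8)) {i : ℕ} (hi : i < w.length) :
    traj w (i + 1) = traj w i + vec w[i] := by
  rw [traj, traj, List.take_add_one, List.getElem?_eq_getElem hi, Option.toList_some, wEnd_append, wEnd_cons,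
    wEnd_nil, add_zero]

/-- After the last step the position is frozen. [cite: MadrasSlade1993, §1.1] -/
theorem traj_of_le (w : List (Fin 8)) {i : ℕ} (hi : w.length ≤ i) : traj w i = wEnd w := by
  rw [traj, List.take_of_length_le hi]

/-- The word as a vertex function of `ℤ⁴` frozen after time `n`. [cite: MadrasSlade1993, §1.1] -/
def walkOf (n : ℕ) (w : List (Fin 8)) : ℕ → Site 4 := fun i => traj w (min i n)

/-! ### The fast vertex list (integer quads) and the height list -/

/-- Coordinates of a site as an integer quadruple. [cite: MadrasSlade1993, §1.1] -/
def quad (x : Site 4) : ℤ × ℤ × ℤ × ℤ := (x 0, x 1, x 2, x 3)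

/-- `quad` is injective. [cite: MadrasSlade1993, §1.1] -/
theorem quad_injective : Function.Injective quad := by
  intro x y h
  simp only [quad, Prod.mk.injEq] at h
  funext i
  fin_cases i
  · exact h.1
  · exact h.2.1
  · exact h.2.2.1
  · exact h.2.2.2

/-- One step on integer quads (the fast form of `p + vec a`). [cite: MadrasSlade1993, §1.1] -/
def tstep (a : Fin 8) (p : ℤ × ℤ × ℤ × ℤ) : ℤ × ℤ × ℤ × ℤ :=
  match a.val with
  | 0 => (p.1 + 1, p.2.1, p.2.2.1, p.2.2.2)
  | 1 => (p.1 - 1, p.2.1, p.2.2.1, p.2.2.2)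
  | 2 => (p.1, p.2.1 + 1, p.2.2.1, p.2.2.2)
  | 3 => (p.1, p.2.1 - 1, p.2.2.1, p.2.2.2)
  | 4 => (p.1, p.2.1, p.2.2.1 + 1, p.2.2.2)
  | 5 => (p.1, p.2.1, p.2.2.1 - 1, p.2.2.2)
  | 6 => (p.1, p.2.1, p.2.2.1, p.2.2.2 + 1)
  | _ => (p.1, p.2.1, p.2.2.1, p.2.2.2 - 1)

/-- `tstep a (quad x) = quad (x + vec a)`. [cite: MadrasSlade1993, §1.1] -/
theorem tstep_quad (a : Fin 8) (x : Site 4) : tstep a (quad x) = quad (x + vec a) := by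
  fin_cases a <;> simp [tstep, quad, vec, dx, dy, dz, dw] <;> ring

/-- Folding the fast steps from `quad x` reaches `quad (x + wEnd w)`. [cite: MadrasSlade1993, §1.1] -/
theorem foldl_tstep_eq (w : List (Fin 8)) (x : Site 4) :
    w.foldl (fun p a => tstep a p) (quad x) = quad (x + wEnd w) := by
  induction w generalizing x with
  | nil => simp
  | cons a w ih => rw [List.foldl_cons, tstep_quad, ih, wEnd_cons, add_assoc]

/-- The fast vertex list: the visited quads, one `scanl` over the word. [cite: MadrasSlade1993, §1.1] -/
def posList (w : List (Fin 8)) : List (ℤ × ℤ × ℤ × ℤ) := w.scanl (fun p a => tstep a p) (0, 0, 0, 0)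

/-- **The fast vertex list is the true one**: `posList w = [quad (traj w 0), …, quad (traj w |w|)]`.
[cite: MadrasSlade1993, §1.1] -/
theorem posList_eq_map (w : List (Fin 8)) :
    posList w = (List.range (w.length + 1)).map fun i => quad (traj w i) := by
  rw [posList, scanl_eq_map_range]
  refine List.map_congr_left fun i _ => ?_
  have h := foldl_tstep_eq (w.take i) 0
  rw [zero_add] at h
  exact h

/-- The height list `X_0, …, X_{|w|}` (first coordinates). [cite: MadrasSlade1993, Definition 1.2.4 (p. 10)] -/
def hts (w : List (Fin 8)) : List ℤ := (posList w).map fun p => p.1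

/-- Entries of `hts`. [cite: MadrasSlade1993, Definition 1.2.4 (p. 10)] -/
theorem hts_getD (w : List (Fin 8)) {i : ℕ} (hi : i ≤ w.length) : (hts w).getD i 0 = traj w i 0 := by
  rw [hts, posList_eq_map, List.map_map, List.getD_eq_getElem _ _ (by simpa using Nat.lt_succ_of_le hi)]
  simp [quad]

/-- The height of `walkOf n w` at time `i ≤ n` is the `i`-th entry of `hts`.
[cite: MadrasSlade1993, Definition 1.2.4 (p. 10)] -/
theorem walkOf_apply_zero (w : List (Fin 8)) {n i : ℕ} (hn : w.length = n) (hi : i ≤ n) :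
    walkOf n w i 0 = (hts w).getD i 0 := by
  rw [walkOf, min_eq_left hi, hts_getD w (by omega)]

/-! ### Soundness of the height-list tests for `ℤ⁴` words -/

/-- `segB` on `hts w` is the tree's `Zd.IsBridge` for the shifted vertex function.
[cite: MadrasSlade1993, Definition 1.2.4 (p. 10)] -/
theorem segB_iff {n : ℕ} {w : List (Fin 8)} (hn : w.length = n) {a b : ℕ} (hab : a + b ≤ n) :
    segB (hts w) a b = true ↔ IsBridge b (fun j => walkOf n w (a + j)) := by
  have e : ∀ j, j ≤ b → walkOf n w (a + j) 0 = (hts w).getD (a + j) 0 :=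
    fun j hj => walkOf_apply_zero w hn (by omega)
  simp only [segB, List.all_eq_true, List.mem_range'_1, decide_eq_true_eq, IsBridge]
  constructor
  · intro h i h1 h2
    rw [e 0 (Nat.zero_le _), e i h2, e b le_rfl, Nat.add_zero]
    exact h i ⟨h1, by omega⟩
  · intro h i hi
    have := h i hi.1 (by omega)
    rwa [e 0 (Nat.zero_le _), e i (by omega), e b le_rfl, Nat.add_zero] at this

/-- **Soundness of the fast test**: `irrB n (hts w)` implies that `walkOf n w` is an irreducible bridge in the sense
of the tree. [cite: MadrasSlade1993, Definition 4.2.1 (p. 89)] -/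
theorem isIrreducibleBridge_of_irrB {n : ℕ} {w : List (Fin 8)} (hn : w.length = n)
    (h : irrB n (hts w) = true) : IsIrreducibleBridge n (walkOf n w) := by
  simp only [irrB, Bool.and_eq_true, decide_eq_true_eq, List.all_eq_true, List.mem_range'_1] at h
  obtain ⟨⟨h1, hB⟩, hI⟩ := h
  refine ⟨h1, ?_, fun k hk1 hk2 hR => ?_⟩
  · have := (segB_iff hn (show 0 + n ≤ n by omega)).1 hB
    simpa only [Nat.zero_add] using this
  · obtain ⟨-, hb1, hb2⟩ := hR
    have hk := hI k ⟨hk1, by omega⟩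
    have e1 : segB (hts w) 0 k = true :=
      (segB_iff hn (show 0 + k ≤ n by omega)).2 (by simpa only [Nat.zero_add] using hb1)
    have e2 : segB (hts w) k (n - k) = true := (segB_iff hn (by omega)).2 hb2
    simp [e1, e2] at hk

/-! ### The acceptance test and its soundness -/

/-- **The acceptance test for one word**: length `n`, no repeated vertex (on the fast vertex list), and the height
list passes `irrB n`. [cite: MadrasSlade1993, Definition 4.2.1 (p. 89)] -/
def WordOK (n : ℕ) (w : List (Fin 8)) : Prop :=
  w.length = n ∧ (posList w).Nodup ∧ irrB n (hts w) = true

/-- `WordOK n w` is decidable. [cite: MadrasSlade1993, Definition 4.2.1 (p. 89)] -/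
instance (n : ℕ) (w : List (Fin 8)) : Decidable (WordOK n w) :=
  inferInstanceAs (Decidable (w.length = n ∧ (posList w).Nodup ∧ irrB n (hts w) = true))

/-- A word with no repeated vertex codes a self-avoiding walk: `walkOf n w ∈ saws 4 n`.
[cite: MadrasSlade1993, Definition 1.1.1 (p. 1)] -/
theorem walkOf_mem_saws {n : ℕ} {w : List (Fin 8)} (hn : w.length = n) (hnd : (posList w).Nodup) :
    walkOf n w ∈ saws 4 n := by
  rw [posList_eq_map, List.nodup_map_iff_inj_on List.nodup_range] at hnd
  refine mem_saws.2 ⟨by simp [walkOf], fun i hi => by simp [walkOf, min_eq_right hi], fun i hi => ?_,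
    fun i hi j hj hij => ?_⟩
  · simp only [walkOf, min_eq_left hi.le, min_eq_left (Nat.succ_le_of_lt hi)]
    rw [traj_succ w (by omega)]
    exact adj_add_vec _ _
  · simp only [Set.mem_setOf_eq] at hi hj
    simp only [walkOf, min_eq_left hi, min_eq_left hj] at hij
    exact hnd i (List.mem_range.2 (by omega)) j (List.mem_range.2 (by omega))
      (congrArg quad hij)

/-- The vertex function of an accepted word is an irreducible bridge of `ℤ⁴`.
[cite: MadrasSlade1993, Definition 4.2.1 (p. 89)] -/
theorem mem_irreducibleBridges_of_wordOK {n : ℕ} {w : List (Fin 8)} (h : WordOK n w) :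
    walkOf n w ∈ irreducibleBridges 4 n := by
  obtain ⟨hl, hnd, hB⟩ := h
  have hirr := isIrreducibleBridge_of_irrB hl hB
  exact mem_irreducibleBridges.2 ⟨mem_bridges.2 ⟨walkOf_mem_saws hl hnd, hirr.2.1⟩, hirr⟩

/-- `walkOf n` is injective on accepted words (successive differences recover the letters).
[cite: MadrasSlade1993, §1.1] -/
theorem walkOf_injOn (n : ℕ) : Set.InjOn (walkOf n) {w | WordOK n w} := by
  intro w hw w' hw' h
  have hl : w.length = n := hw.1
  have hl' : w'.length = n := hw'.1
  have ht : ∀ i ≤ n, traj w i = traj w' i := fun i hi => by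
    have := congrFun h i
    simpa only [walkOf, min_eq_left hi] using this
  refine List.ext_getElem (hl.trans hl'.symm) fun i hi hi' => ?_
  have h1 := traj_succ w hi
  have h2 := traj_succ w' hi'
  rw [ht i (by omega), ht (i + 1) (by omega), h2, add_right_inj] at h1
  exact vec_injective h1.symm

/-- **The certificate check** on a candidate list: exactly `m` words, each accepted, strictly increasing in the
integer encoding (hence no duplicates). [cite: Jensen2004SAWLowerBounds, §2] -/
def certL (n m : ℕ) (L : List (List (Fin 8))) : Bool :=
  decide (L.length = m) && L.all (fun w => decide (WordOK n w)) && decide (L.IsChain EncLT)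

/-- **Soundness**: a list passing `certL n m` certifies `m ≤ λ_n(ℤ⁴)`. [cite: Jensen2004SAWLowerBounds, §2]
[cite: MadrasSlade1993, Definition 4.2.1 (p. 89)] -/
theorem le_of_certL {n m : ℕ} {L : List (List (Fin 8))} (h : certL n m L = true) :
    m ≤ irreducibleBridgeCount 4 n := by
  classical
  simp only [certL, Bool.and_eq_true, decide_eq_true_eq, List.all_eq_true] at h
  obtain ⟨⟨hlen, hall⟩, hchain⟩ := h
  have hnd : L.Nodup := nodup_of_chain hchain
  have hOK : ∀ w ∈ L.toFinset, WordOK n w := fun w hw => hall w (List.mem_toFinset.1 hw)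
  calc m = L.toFinset.card := by rw [List.toFinset_card_of_nodup hnd, hlen]
    _ = (L.toFinset.image (walkOf n)).card := by
        rw [Finset.card_image_of_injOn fun w hw w' hw' hww' => walkOf_injOn n (hOK w hw) (hOK w' hw') hww']
    _ ≤ (irreducibleBridges 4 n).card := by
        refine Finset.card_le_card fun ω hω => ?_
        obtain ⟨w, hw, rfl⟩ := Finset.mem_image.1 hω
        exact mem_irreducibleBridges_of_wordOK (hOK w hw)
    _ = irreducibleBridgeCount 4 n := rfl

/-! ### The untrusted search -/

/-- The half-space depth-first search over step words of `ℤ⁴` (pruned on self-avoidance and `X > 0`), emitting at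
depth `k = 0` the words whose height array passes `leafOK`, in increasing lexicographic order. Untrusted.
[cite: Jensen2004SAWLowerBounds, §2] -/
def go :
    ℕ → List (Fin 8) → ℤ × ℤ × ℤ × ℤ → List (ℤ × ℤ × ℤ × ℤ) → Array ℤ → List (List (Fin 8)) → List (List (Fin 8))
  | 0, wr, _, _, hs, acc => if leafOK hs then wr.reverse :: acc else acc
  | k + 1, wr, p, vis, hs, acc =>
    let ext : Fin 8 → List (List (Fin 8)) → List (List (Fin 8)) := fun a acc' =>
      let q := tstep a p
      if q.1 ≤ 0 || vis.elem q then acc' else go k (a :: wr) q (q :: vis) (hs.push q.1) acc'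
    ext 0 (ext 1 (ext 2 (ext 3 (ext 4 (ext 5 (ext 6 (ext 7 acc)))))))

/-- The (untrusted) list of step words of the `n`-step irreducible bridges of `ℤ⁴`.
[cite: Jensen2004SAWLowerBounds, §2] -/
def dfs (n : ℕ) : List (List (Fin 8)) := go n [] (0, 0, 0, 0) [(0, 0, 0, 0)] #[0] []

/-! ### The evaluations (computational class: one `native_decide` each) -/

/-- `λ_1(ℤ⁴) ≥ 1`. [cite: Jensen2004SAWLowerBounds, §2] -/
theorem le_lambda_one : 1 ≤ irreducibleBridgeCount 4 1 := le_of_certL (L := dfs 1) (by native_decide)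

/-- `λ_2(ℤ⁴) ≥ 6`. [cite: Jensen2004SAWLowerBounds, §2] -/
theorem le_lambda_two : 6 ≤ irreducibleBridgeCount 4 2 := le_of_certL (L := dfs 2) (by native_decide)

/-- `λ_3(ℤ⁴) ≥ 30`. [cite: Jensen2004SAWLowerBounds, §2] -/
theorem le_lambda_three : 30 ≤ irreducibleBridgeCount 4 3 := le_of_certL (L := dfs 3) (by native_decide)

/-- `λ_4(ℤ⁴) ≥ 150`. [cite: Jensen2004SAWLowerBounds, §2] -/
theorem le_lambda_four : 150 ≤ irreducibleBridgeCount 4 4 := le_of_certL (L := dfs 4) (by native_decide)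

/-- `λ_5(ℤ⁴) ≥ 726`. [cite: Jensen2004SAWLowerBounds, §2] -/
theorem le_lambda_five : 726 ≤ irreducibleBridgeCount 4 5 := le_of_certL (L := dfs 5) (by native_decide)

/-- `λ_6(ℤ⁴) ≥ 3564`. [cite: Jensen2004SAWLowerBounds, §2] -/
theorem le_lambda_six : 3564 ≤ irreducibleBridgeCount 4 6 := le_of_certL (L := dfs 6) (by native_decide)

/-- `λ_7(ℤ⁴) ≥ 17526`. [cite: Jensen2004SAWLowerBounds, §2] -/
theorem le_lambda_seven : 17526 ≤ irreducibleBridgeCount 4 7 := le_of_certL (L := dfs 7) (by native_decide)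

/-- `λ_8(ℤ⁴) ≥ 89094`. [cite: Jensen2004SAWLowerBounds, §2] -/
theorem le_lambda_eight : 89094 ≤ irreducibleBridgeCount 4 8 := le_of_certL (L := dfs 8) (by native_decide)

/-- `λ_9(ℤ⁴) ≥ 466824`. [cite: Jensen2004SAWLowerBounds, §2] -/
theorem le_lambda_nine : 466824 ≤ irreducibleBridgeCount 4 9 := le_of_certL (L := dfs 9) (by native_decide)

end QuarticIrrCert

/-! ### The numeral -/

open QuarticIrrCert in
/-- **`μ(ℤ⁴) > 5.87`**: `587/100 < connectiveConstant 4`, from `Σ_{n ≤ 9} λ_n(ℤ⁴) (100/587)^n > 1` and Kesten's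
inequality `Σ_n λ_n μ^{-n} ≤ 1` (`Zd.inv_lt_connectiveConstant_of_one_lt_sum`). Printed bounds: `6.71800`
(Madras–Slade Table 1.1, Hara–Slade 1992b) and the bound of record `6.742945` (Hara–Slade–Sokal 1993); this one is
weaker but kernel-checked. [cite: MadrasSlade1993, Table 1.1 (p. 12), d = 4 row; §1.2 (1.2.15)–(1.2.17) (p. 11); eq. (4.2.4) (p. 91)]
[cite: HaraSladeSokal1993, results table, d = 4: μ ≥ 6.742945] [cite: HaraSlade1992b, Appendix A (lower bounds on μ(d), d = 4)]
[cite: Kesten1963SAW, §4] [cite: Jensen2004SAWLowerBounds, §2 (Kesten's truncation principle)] -/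
theorem connectiveConstant_four_gt_587_div_100 : (587 : ℝ) / 100 < connectiveConstant 4 := by
  have hx : (0 : ℝ) < 100 / 587 := by norm_num
  have key : (1 : ℝ) < ∑ k ∈ Finset.range 10, (irreducibleBridgeCount 4 k : ℝ) * (100 / 587) ^ k := by
    have h1 : (1 : ℝ) ≤ irreducibleBridgeCount 4 1 := by exact_mod_cast le_lambda_one
    have h2 : (6 : ℝ) ≤ irreducibleBridgeCount 4 2 := by exact_mod_cast le_lambda_two
    have h3 : (30 : ℝ) ≤ irreducibleBridgeCount 4 3 := by exact_mod_cast le_lambda_three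
    have h4 : (150 : ℝ) ≤ irreducibleBridgeCount 4 4 := by exact_mod_cast le_lambda_four
    have h5 : (726 : ℝ) ≤ irreducibleBridgeCount 4 5 := by exact_mod_cast le_lambda_five
    have h6 : (3564 : ℝ) ≤ irreducibleBridgeCount 4 6 := by exact_mod_cast le_lambda_six
    have h7 : (17526 : ℝ) ≤ irreducibleBridgeCount 4 7 := by exact_mod_cast le_lambda_seven
    have h8 : (89094 : ℝ) ≤ irreducibleBridgeCount 4 8 := by exact_mod_cast le_lambda_eight
    have h9 : (466824 : ℝ) ≤ irreducibleBridgeCount 4 9 := by exact_mod_cast le_lambda_nine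
    simp only [Finset.sum_range_succ, Finset.sum_range_zero, irreducibleBridgeCount_zero]
    generalize irreducibleBridgeCount 4 1 = a1 at h1 ⊢
    generalize irreducibleBridgeCount 4 2 = a2 at h2 ⊢
    generalize irreducibleBridgeCount 4 3 = a3 at h3 ⊢
    generalize irreducibleBridgeCount 4 4 = a4 at h4 ⊢
    generalize irreducibleBridgeCount 4 5 = a5 at h5 ⊢
    generalize irreducibleBridgeCount 4 6 = a6 at h6 ⊢
    generalize irreducibleBridgeCount 4 7 = a7 at h7 ⊢
    generalize irreducibleBridgeCount 4 8 = a8 at h8 ⊢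
    generalize irreducibleBridgeCount 4 9 = a9 at h9 ⊢
    push_cast
    norm_num
    linarith [h1, h2, h3, h4, h5, h6, h7, h8, h9]
  have := inv_lt_connectiveConstant_of_one_lt_sum 4 _ hx key
  rwa [inv_div] at this

end Literature.Probability.RandomPlanarGeometry.SAW.Zd
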